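import Literature.MathematicalPhysics.QuantumLattice.FinDimSpectrumProofs
import HarnessLib

/-!
# The zero-temperature limit of the quantum Gibbs state (`FinDimSpectrum`, discharge)

Trunk T-QLATTICE. Second sibling proof file of
`Literature/MathematicalPhysics/QuantumLattice/FinDimSpectrum.lean` (after
`FinDimSpectrumProofs.lean`, whose ground-state-projection API it uses). It discharges the named
fact

* `Matrix.tendsto_gibbsState_atTop_holds : tendsto_gibbsState_atTop` — for a Hermitian `H` on a
  nonempty finite index type and any observable `A`,
  `⟨A⟩_β = tr (e^{-βH} A) / tr e^{-βH} ⟶ tr (P₀ A) / tr P₀ = H.groundStateFunctional A` as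
  `β → ∞`, where `P₀ = H.groundProj` is the orthogonal projection onto the ground space
  `ker (H - E₀)`.

This is the finite-dimensional statement that "the ground state(s) are the `β ↑ ∞` limit of the
equilibrium (Gibbs) state", the limit being the uniform mixture of all ground states when they are
degenerate: H. Tasaki, *Physics and Mathematics of Quantum Many-Body Systems* (2020), App. A
(expectation values in ground states and in thermal equilibrium) — the cite carried by the fact —
and O. Bratteli, D. W. Robinson, *Operator Algebras and Quantum Statistical Mechanics II*, §5.3.1
(ground states as zero-temperature limits of Gibbs / KMS states). No statement is introduced or
changed here; the two auxiliary identities below are elementary linear algebra. [folklore]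

On the way:

* `Matrix.IsHermitian.groundProj_mulVec_eigenvectorBasis_of_eq / _of_ne` — the eigenvector basis
  diagonalises `P₀`: `P₀ bⱼ = bⱼ` if `λⱼ = E₀` and `P₀ bⱼ = 0` otherwise;
* `Matrix.IsHermitian.groundProj_eq_conj_diagonal` — **the ground-state projection is the
  spectral projection** `P₀ = U diag(𝟙[λᵢ = E₀]) U⋆ = 𝟙_{{E₀}}(H)` in the eigenbasis
  `U = hH.eigenvectorUnitary` of Mathlib's spectral theorem
  (`Matrix.IsHermitian.spectral_theorem`).

## Proof

Write `H = U diag(λ) U⋆`, `E₀ = min λ = H.groundEnergy` (`groundEnergy_eq_iInf_eigenvalues_holds`,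
`groundEnergy_le_eigenvalues`). By the Hermitian functional calculus
(`Matrix.IsHermitian.cfc_eq`, `CFC.real_exp_eq_normedSpace_exp`)
`e^{-βH} = U diag(e^{-βλᵢ}) U⋆ = e^{-βE₀} · W_β` with `W_β = U diag(e^{-β(λᵢ - E₀)}) U⋆`, and
the scalar `e^{-βE₀} > 0` cancels: `⟨A⟩_β = tr (W_β A) / tr W_β`. Entrywise
`e^{-β(λᵢ - E₀)} → 𝟙[λᵢ = E₀]` (`Real.tendsto_exp_neg_atTop_nhds_zero` for `λᵢ > E₀`), so by
continuity of `v ↦ U diag(v) U⋆` and of the trace, `W_β → U diag(𝟙[λᵢ = E₀]) U⋆ = P₀` and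
`⟨A⟩_β → tr (P₀ A) / tr P₀`, using `tr P₀ ≠ 0` (`trace_groundProj_ne_zero`). The identification
of `U diag(𝟙[λᵢ = E₀]) U⋆` with `P₀ = groundProj H` (defined through Mathlib's
`Submodule.starProjection`) is checked on the eigenvector basis: `P₀` fixes ground-state vectors
(`groundProj_mulVec_of_mem`), and for `λⱼ ≠ E₀` the two evaluations of `P₀ H bⱼ`
(`P₀ H = E₀ P₀`, `groundProj_mul`; `H bⱼ = λⱼ bⱼ`) give `(λⱼ - E₀) P₀ bⱼ = 0`.

## Design notes

Everything is over `ℂ`, `[Fintype n] [DecidableEq n]`, in Mathlib's `Matrix` namespace as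
deliberate dot-notation extensions (like the fact itself and `FinDimSpectrumProofs.lean`). The
diagonal form of `e^{-βH}` is re-derived inline (three lines) rather than imported from
`DuhamelTwoPoint.lean` (`Matrix.IsHermitian.gibbsWeight_eq`), which imports this file's parent
and heavy measure theory.
-/
noncomputable section

open scoped Matrix.Norms.L2Operator ComplexOrder MatrixOrder InnerProductSpace

namespace Matrix

open Literature.MathematicalPhysics.QuantumLattice Filter Topology

variable {n : Type*} [Fintype n] [DecidableEq n]

/-! ### The ground-state projection in the eigenbasis -/

/-- An eigenvector of the orthonormal eigenbasis of a Hermitian `H` whose eigenvalue is the ground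
energy is fixed by the ground-state projection: `P₀ bⱼ = bⱼ` if `λⱼ = E₀`
(`groundProj_mulVec_of_mem`). [folklore] -/
theorem IsHermitian.groundProj_mulVec_eigenvectorBasis_of_eq {H : Matrix n n ℂ}
    (hH : H.IsHermitian) {j : n} (hj : hH.eigenvalues j = H.groundEnergy) :
    H.groundProj *ᵥ ⇑(hH.eigenvectorBasis j) = ⇑(hH.eigenvectorBasis j) := by
  apply groundProj_mulVec_of_mem
  rw [mem_groundSpace_iff, hH.mulVec_eigenvectorBasis j, RCLike.real_smul_eq_coe_smul (K := ℂ), hj]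
  rfl

/-- An eigenvector of the orthonormal eigenbasis of a Hermitian `H` whose eigenvalue is not the
ground energy is annihilated by the ground-state projection: `P₀ bⱼ = 0` if `λⱼ ≠ E₀`. (Evaluate
`P₀ (H bⱼ)` twice: `P₀ H = E₀ P₀` (`groundProj_mul`) and `H bⱼ = λⱼ bⱼ` give
`(λⱼ - E₀) • P₀ bⱼ = 0`.) [folklore] -/
theorem IsHermitian.groundProj_mulVec_eigenvectorBasis_of_ne {H : Matrix n n ℂ}
    (hH : H.IsHermitian) {j : n} (hj : hH.eigenvalues j ≠ H.groundEnergy) :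
    H.groundProj *ᵥ ⇑(hH.eigenvectorBasis j) = 0 := by
  have h1 : H.groundProj *ᵥ (H *ᵥ ⇑(hH.eigenvectorBasis j)) =
      (H.groundEnergy : ℂ) • (H.groundProj *ᵥ ⇑(hH.eigenvectorBasis j)) := by
    rw [mulVec_mulVec, groundProj_mul hH, smul_mulVec]
  have h2 : H.groundProj *ᵥ (H *ᵥ ⇑(hH.eigenvectorBasis j)) =
      (hH.eigenvalues j : ℂ) • (H.groundProj *ᵥ ⇑(hH.eigenvectorBasis j)) := by
    rw [hH.mulVec_eigenvectorBasis j, RCLike.real_smul_eq_coe_smul (K := ℂ), mulVec_smul]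
    rfl
  have h3 : ((hH.eigenvalues j : ℂ) - (H.groundEnergy : ℂ)) •
      (H.groundProj *ᵥ ⇑(hH.eigenvectorBasis j)) = 0 := by
    rw [sub_smul, ← h1, ← h2, sub_self]
  have hne : (hH.eigenvalues j : ℂ) - (H.groundEnergy : ℂ) ≠ 0 := by
    rw [sub_ne_zero, Ne, Complex.ofReal_inj]
    exact hj
  exact (smul_eq_zero.1 h3).resolve_left hne

/-- **The ground-state projection is the spectral projection of `{E₀}`**: in the eigenbasis
`U = hH.eigenvectorUnitary` of Mathlib's spectral theorem, `P₀ = U diag(𝟙[λᵢ = E₀]) U⋆`, i.e.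
`groundProj H = 𝟙_{{E₀}}(H)`. (Both sides agree on the columns `bⱼ = U eⱼ` by the two previous
lemmas, so `P₀ U = U diag(𝟙[λᵢ = E₀])`; multiply by `U⋆`.) Tasaki (2020) App. A (projection onto
the space of ground states); Reed–Simon I, Thm. VII.2 (functional calculus). [folklore] -/
theorem IsHermitian.groundProj_eq_conj_diagonal {H : Matrix n n ℂ} (hH : H.IsHermitian) :
    H.groundProj = (hH.eigenvectorUnitary : Matrix n n ℂ) *
      diagonal (fun i => if hH.eigenvalues i = H.groundEnergy then (1 : ℂ) else 0) *
        star (hH.eigenvectorUnitary : Matrix n n ℂ) := by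
  have hUU : (hH.eigenvectorUnitary : Matrix n n ℂ) *
      star (hH.eigenvectorUnitary : Matrix n n ℂ) = 1 :=
    Unitary.mul_star_self_of_mem hH.eigenvectorUnitary.prop
  have key : ∀ j, H.groundProj *ᵥ ⇑(hH.eigenvectorBasis j) =
      (if hH.eigenvalues j = H.groundEnergy then (1 : ℂ) else 0) • ⇑(hH.eigenvectorBasis j) := by
    intro j
    by_cases hj : hH.eigenvalues j = H.groundEnergy
    · rw [hH.groundProj_mulVec_eigenvectorBasis_of_eq hj, if_pos hj, one_smul]
    · rw [hH.groundProj_mulVec_eigenvectorBasis_of_ne hj, if_neg hj, zero_smul]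
  have hPU : H.groundProj * (hH.eigenvectorUnitary : Matrix n n ℂ) =
      (hH.eigenvectorUnitary : Matrix n n ℂ) *
        diagonal (fun i => if hH.eigenvalues i = H.groundEnergy then (1 : ℂ) else 0) := by
    ext i j
    have h1 : (H.groundProj * (hH.eigenvectorUnitary : Matrix n n ℂ)) i j =
        (H.groundProj *ᵥ ⇑(hH.eigenvectorBasis j)) i := by
      simp only [mul_apply, mulVec, dotProduct, IsHermitian.eigenvectorUnitary_apply]
    rw [h1, key j, mul_diagonal, Pi.smul_apply, smul_eq_mul, mul_comm,
      IsHermitian.eigenvectorUnitary_apply]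
  rw [← hPU, Matrix.mul_assoc, hUU, Matrix.mul_one]

/-! ### The zero-temperature limit -/

/-- Discharge of the named fact `tendsto_gibbsState_atTop` (**zero-temperature limit of the Gibbs
state**): for a Hermitian `H` on a nonempty finite index type and every observable `A`,
`gibbsState β H A = tr (e^{-βH} A) / tr e^{-βH} ⟶ tr (P₀ A) / tr P₀ = groundStateFunctional H A`
as `β → ∞` — the `β ↑ ∞` limit of the equilibrium state is the (uniform mixture of the) ground
state(s). Proof: `e^{-βH} = e^{-βE₀} · U diag(e^{-β(λᵢ - E₀)}) U⋆` (Hermitian functional calculus),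
the positive scalar cancels in the quotient, `e^{-β(λᵢ - E₀)} → 𝟙[λᵢ = E₀]`, continuity of
`v ↦ U diag(v) U⋆` and of the trace, `U diag(𝟙[λᵢ = E₀]) U⋆ = P₀`
(`IsHermitian.groundProj_eq_conj_diagonal`) and `tr P₀ ≠ 0` (`trace_groundProj_ne_zero`).
Tasaki (2020), App. A; Bratteli–Robinson II, §5.3.1. [cite: Tasaki2020, App. A] -/
theorem tendsto_gibbsState_atTop_holds : tendsto_gibbsState_atTop (n := n) := by
  intro H hH _ A
  -- the rescaled Boltzmann weights `e^{-β(λᵢ - E₀)}`, their limits, and `W β = U diag(⋯) U⋆`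
  let U : Matrix n n ℂ := (hH.eigenvectorUnitary : Matrix n n ℂ)
  let d : ℝ → n → ℂ := fun β i => (Real.exp (-(β * (hH.eigenvalues i - H.groundEnergy))) : ℂ)
  let dinf : n → ℂ := fun i => if hH.eigenvalues i = H.groundEnergy then 1 else 0
  let W : ℝ → Matrix n n ℂ := fun β => U * diagonal (d β) * star U
  -- (1) `e^{-βH} = e^{-βE₀} • W β`
  have hG : ∀ β, gibbsWeight β H = (Real.exp (-(β * H.groundEnergy)) : ℂ) • W β := by
    intro β
    have hsmul : (-(β : ℂ) • H : Matrix n n ℂ) = (-β : ℝ) • H := by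
      ext i j
      simp [Matrix.smul_apply, Complex.real_smul]
    have h1 : gibbsWeight β H = cfc (fun x : ℝ => Real.exp ((-β) • x)) H := by
      rw [gibbsWeight, hsmul, cfc_comp_smul (-β) Real.exp H, CFC.real_exp_eq_normedSpace_exp]
    have h2 : gibbsWeight β H =
        U * diagonal (fun i => (Real.exp (-(β * hH.eigenvalues i)) : ℂ)) * star U := by
      rw [h1, hH.cfc_eq, IsHermitian.cfc, Unitary.conjStarAlgAut_apply]
      simp only [smul_eq_mul, neg_mul]
      rfl
    have h3 : (fun i => (Real.exp (-(β * hH.eigenvalues i)) : ℂ)) =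
        (Real.exp (-(β * H.groundEnergy)) : ℂ) • d β := by
      funext i
      simp only [d, Pi.smul_apply, smul_eq_mul, ← Complex.ofReal_mul, ← Real.exp_add]
      congr 2
      ring
    rw [h2, h3, diagonal_smul, Matrix.mul_smul, Matrix.smul_mul]
  -- (2) the scalar cancels in the Gibbs state
  have hstate : ∀ β, gibbsState β H A = ((W β).trace)⁻¹ * (W β * A).trace := by
    intro β
    have hc : (Real.exp (-(β * H.groundEnergy)) : ℂ) ≠ 0 :=
      Complex.ofReal_ne_zero.2 (Real.exp_pos _).ne'
    rw [gibbsState_apply, partitionFn, hG β, trace_smul, smul_mul_assoc, trace_smul, smul_eq_mul,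
      smul_eq_mul, mul_inv, mul_mul_mul_comm, inv_mul_cancel₀ hc, one_mul]
  -- (3) `d β → dinf` entrywise
  have hd : Tendsto d atTop (𝓝 dinf) := by
    rw [tendsto_pi_nhds]
    intro i
    by_cases hi : hH.eigenvalues i = H.groundEnergy
    · have h0 : (fun β => d β i) = fun _ => (1 : ℂ) := by
        funext β
        simp [d, hi]
      rw [h0]
      simp only [dinf, if_pos hi]
      exact tendsto_const_nhds
    · have hlt : H.groundEnergy < hH.eigenvalues i :=
        lt_of_le_of_ne (groundEnergy_le_eigenvalues hH i) (Ne.symm hi)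
      have h1 : Tendsto (fun β : ℝ => β * (hH.eigenvalues i - H.groundEnergy)) atTop atTop :=
        tendsto_id.atTop_mul_const (sub_pos.2 hlt)
      have h2 := (Complex.continuous_ofReal.tendsto 0).comp
        (Real.tendsto_exp_neg_atTop_nhds_zero.comp h1)
      simp only [dinf, if_neg hi]
      simpa [d, Function.comp_def] using h2
  -- (4) hence `W β → P₀`, and the traces converge
  have hφ : Continuous fun v : n → ℂ => U * diagonal v * star U :=
    (continuous_const.matrix_mul continuous_id.matrix_diagonal).matrix_mul continuous_const
  have hW : Tendsto W atTop (𝓝 H.groundProj) := by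
    rw [hH.groundProj_eq_conj_diagonal]
    exact (hφ.tendsto dinf).comp hd
  have htr : Tendsto (fun β => (W β).trace) atTop (𝓝 H.groundProj.trace) :=
    (continuous_id.matrix_trace.tendsto _).comp hW
  have htrA : Tendsto (fun β => (W β * A).trace) atTop (𝓝 (H.groundProj * A).trace) :=
    ((continuous_id.matrix_mul continuous_const).matrix_trace.tendsto _).comp hW
  have hfun : (fun β : ℝ => gibbsState β H A) = fun β => ((W β).trace)⁻¹ * (W β * A).trace :=
    funext hstate
  rw [hfun, groundStateFunctional_apply]
  exact (htr.inv₀ (trace_groundProj_ne_zero hH)).mul htrA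

end Matrix
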